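import Summits.QuantumFields.YangMills.Theorems.BalabanLadderUVSeamRecCeilingsDefectCollar
import Literature.MathematicalPhysics.QuantumFieldTheory.LatticeGaugeShenZhuZhuProofs
import HarnessLib

/-!
# Crux `UVSeamRec` (stmt-QuantumFields-20043), stub `stub_ceilings` (E0′): tools for the RARITY half of the defect collar

Helper file (`--supports stmt-QuantumFields-20043`) of the stub seat `ym-20043-seam-s2`; sibling of
`BalabanLadderUVSeamRecCeilingsDefectCollar.lean` (the defect collar: good-exterior kernel law + MULTIPLICATIVE RARITY
`μ(⋂_{i∈T} Badᵢ) ≤ δ^{#T}` of the bad cube-exteriors ⇒ ceilings) and `…DefectCollarMoments.lean`.  HONEST FRAMING: pure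
measure theory / DLR bookkeeping; nothing about Yang–Mills at weak coupling is asserted; not E0′, not a gap, not Clay.

* §1 How multiplicative rarity for ARBITRARY separated cubes is obtained from a rarity bound for the blocks of finitely
  many TILINGS (the form a chessboard estimate delivers, Fröhlich–Israel–Lieb–Simon 1978 Thm. 4.1 — tree
  `Literature.Probability.LatticeModels.chessboard_le_rpow_even` / `_odd`): `integral_prod_indicator_eq_measureReal`
  (the integral form used by the defect collar is the measure of the intersection), `measureReal_biInter_le_of_cover`
  (each bad event inside ONE block event `B (c i)` of a tiling with fibres of the assignment `c` of size `≤ m₁` and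
  tiling rarity `μ(⋂_{k∈A} B k) ≤ δ₀^{#A}` ⇒ `μ(⋂_{i∈T} Badᵢ) ≤ (δ₀^{1/m₁})^{#T}`) and `measureReal_biInter_le_of_classes`
  (pigeonhole over `s` classes — e.g. the `2^d` half-shifted tilings, one of which swallows any given cube of diameter
  `≤ w/2` in a single block: `μ(⋂_{i∈T} Badᵢ) ≤ (δ^{1/s})^{#T}` from the bound on the largest class) and
  `measureReal_biInter_le_of_cover_choice` (each bad event inside the UNION of `≤ m₀` block events of ONE tiling — the blocks
  meeting the cube — fibres `≤ m₁`: `μ(⋂_{i∈T} Badᵢ) ≤ (m₀·δ₀^{1/m₁})^{#T}` by the union bound over choice functions; no shifted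
  tilings needed).
* §2 Why the rarity must be a TORUS-STATE statement: `integral_integral_ymSpecification_of_subset` (consistency
  `γ_{Λ'} γ_Λ = γ_{Λ'}` of the lattice Yang–Mills specification for bounded continuous observables, from the tree's
  `isSpecification_ymSpecification_of_t2Space`) and `abs_kernel_sub_le_of_inner_law`: an inner good-exterior law
  `|γ_Λ F(σ) − p| ≤ ε` (`σ ∈ Good`) gives, for EVERY outer exterior `ζ`, `|γ_{Λ'}F(ζ) − p| ≤ ε + (C + |p|)·γ_{Λ'}(ζ)(Goodᶜ)`
  — so a KERNEL-level rarity `sup_ζ γ_{Λ'}(ζ)(Goodᶜ) ≤ δ` reproduces a ∀-exterior law for the outer volume; if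
  ∀-exterior laws are false (lead ym-spine-20043-p1 g7: `…UVSeamRecPenetrationDefs.not_fbl6_of_planePenetration`), so
  is kernel-level rarity, and only rarity under the torus state (chessboard) remains.

References: H.-O. Georgii, *Gibbs Measures and Phase Transitions* (2011) Def. 1.23 (iii), Thm. 4.17; J. Fröhlich,
R. Israel, E. H. Lieb, B. Simon, Commun. Math. Phys. 62 (1978) Thm. 4.1; M. Biskup, LNM 1970 (2009) §5.
-/

set_option autoImplicit false

noncomputable section

open MeasureTheory Filter Topology Finset
open Literature.Probability.LatticeModels
open Literature.MathematicalPhysics.QuantumFieldTheory (isSpecification_ymSpecification_of_t2Space)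
open Literature.MathematicalPhysics.QuantumLattice

namespace Summit.QuantumFields.YangMills.Cruxes.UVSeamRec.DefectCollar

/-! ## §1 From tiling rarity to rarity for arbitrary separated cubes -/

section Covering

variable {Ω : Type*} [MeasurableSpace Ω] (μ : Measure Ω) [IsProbabilityMeasure μ]

omit [MeasurableSpace Ω] in
/-- A finite product of `{0,1}`-indicators is the indicator of the intersection. [folklore] -/
theorem prod_indicator_one_eq_indicator_biInter {ι : Type*} (T : Finset ι) (E : ι → Set Ω) (ω : Ω) :
    ∏ i ∈ T, (E i).indicator (fun _ => (1 : ℝ)) ω = (⋂ i ∈ T, E i).indicator (fun _ => (1 : ℝ)) ω := by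
  classical
  by_cases hω : ω ∈ ⋂ i ∈ T, E i
  · rw [Set.indicator_of_mem hω]
    refine Finset.prod_eq_one fun i hi => ?_
    rw [Set.indicator_of_mem (Set.mem_iInter₂.1 hω i hi)]
  · rw [Set.indicator_of_notMem hω]
    obtain ⟨i, hi, hiω⟩ : ∃ i ∈ T, ω ∉ E i := by
      by_contra h
      exact hω (Set.mem_iInter₂.2 fun i hi => by_contra fun hh => h ⟨i, hi, hh⟩)
    exact Finset.prod_eq_zero hi (Set.indicator_of_notMem hiω _)

omit [IsProbabilityMeasure μ] in
/-- **The integral form of the defect collar's rarity hypothesis is the measure of the intersection**: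
`∫ ∏_{i∈T} 1_{Eᵢ} dμ = μ(⋂_{i∈T} Eᵢ)`. [folklore] -/
theorem integral_prod_indicator_eq_measureReal {ι : Type*} (T : Finset ι) (E : ι → Set Ω)
    (hE : ∀ i, MeasurableSet (E i)) :
    ∫ ω, ∏ i ∈ T, (E i).indicator (fun _ => (1 : ℝ)) ω ∂μ = μ.real (⋂ i ∈ T, E i) := by
  simp_rw [prod_indicator_one_eq_indicator_biInter T E]
  have hmeas : MeasurableSet (⋂ i ∈ T, E i) := MeasurableSet.biInter T.countable_toSet fun i _ => hE i
  rw [← integral_indicator_one hmeas]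
  rfl

/-- **Covering by ONE block each, bounded fibres.**  If every bad event `Bad i` (`i ∈ T`) lies inside the block event
`B (c i)` of a tiling, at most `m₁ ≥ 1` indices of `T` are assigned to the same block, and the tiling has multiplicative
rarity `μ(⋂_{k∈A} B k) ≤ δ₀^{#A}` (`0 ≤ δ₀ ≤ 1`; the output of a chessboard estimate with `δ₀` = the universal
constant), then `μ(⋂_{i∈T} Bad i) ≤ (δ₀^{1/m₁})^{#T}`. [folklore] -/
theorem measureReal_biInter_le_of_cover {ι κ : Type*} [DecidableEq κ] (T : Finset ι) (Bad : ι → Set Ω)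
    (B : κ → Set Ω) (c : ι → κ) (hcover : ∀ i ∈ T, Bad i ⊆ B (c i)) {m₁ : ℕ} (hm₁ : 1 ≤ m₁)
    (hfib : ∀ k, (T.filter fun i => c i = k).card ≤ m₁) {δ₀ : ℝ} (hδ₀ : 0 ≤ δ₀) (hδ₁ : δ₀ ≤ 1)
    (hrare : ∀ A : Finset κ, μ.real (⋂ k ∈ A, B k) ≤ δ₀ ^ A.card) :
    μ.real (⋂ i ∈ T, Bad i) ≤ (δ₀ ^ ((1 : ℝ) / m₁)) ^ T.card := by
  have hsub : (⋂ i ∈ T, Bad i) ⊆ ⋂ k ∈ T.image c, B k := by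
    intro ω hω
    refine Set.mem_iInter₂.2 fun k hk => ?_
    obtain ⟨i, hi, rfl⟩ := Finset.mem_image.1 hk
    exact hcover i hi (Set.mem_iInter₂.1 hω i hi)
  have hcard : T.card ≤ m₁ * (T.image c).card :=
    Finset.card_le_mul_card_image _ _ fun k _ => hfib k
  have hroot0 : 0 ≤ δ₀ ^ ((1 : ℝ) / m₁) := Real.rpow_nonneg hδ₀ _
  have hroot1 : δ₀ ^ ((1 : ℝ) / m₁) ≤ 1 := Real.rpow_le_one hδ₀ hδ₁ (by positivity)
  have hm₁' : (m₁ : ℝ) ≠ 0 := by exact_mod_cast (show m₁ ≠ 0 by omega)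
  calc μ.real (⋂ i ∈ T, Bad i) ≤ μ.real (⋂ k ∈ T.image c, B k) := measureReal_mono hsub
    _ ≤ δ₀ ^ (T.image c).card := hrare _
    _ = (δ₀ ^ ((1 : ℝ) / m₁)) ^ (m₁ * (T.image c).card) := by
        rw [pow_mul, ← Real.rpow_natCast (δ₀ ^ ((1 : ℝ) / m₁)) m₁, ← Real.rpow_mul hδ₀,
          one_div_mul_cancel hm₁', Real.rpow_one]
    _ ≤ (δ₀ ^ ((1 : ℝ) / m₁)) ^ T.card := pow_le_pow_of_le_one hroot0 hroot1 hcard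

/-- **Pigeonhole over classes.**  If the indices of `T` fall into the classes `s ∈ S` (e.g. the `2^d` half-shifted
tilings, each cube lying in a single block of at least one of them) and within each class the bad events have
multiplicative rarity `μ(⋂_{i∈T, cls i = s} Bad i) ≤ δ^{#{i∈T | cls i = s}}` (`0 ≤ δ ≤ 1`), then
`μ(⋂_{i∈T} Bad i) ≤ (δ^{1/#S})^{#T}` (bound through the largest class, which has at least `#T/#S` members). [folklore] -/
theorem measureReal_biInter_le_of_classes {ι σ : Type*} [DecidableEq σ] (T : Finset ι) (Bad : ι → Set Ω)
    (cls : ι → σ) (S : Finset σ) (hS : ∀ i ∈ T, cls i ∈ S) (hSpos : 0 < S.card)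
    {δ : ℝ} (hδ0 : 0 ≤ δ) (hδ1 : δ ≤ 1)
    (h : ∀ s ∈ S, μ.real (⋂ i ∈ T.filter (fun i => cls i = s), Bad i) ≤ δ ^ (T.filter fun i => cls i = s).card) :
    μ.real (⋂ i ∈ T, Bad i) ≤ (δ ^ ((1 : ℝ) / S.card)) ^ T.card := by
  -- a class with at least `#T / #S` members
  obtain ⟨s, hs, hbig⟩ : ∃ s ∈ S, T.card ≤ S.card * (T.filter fun i => cls i = s).card := by
    by_contra hcon
    push Not at hcon
    have hsum : T.card = ∑ s ∈ S, (T.filter fun i => cls i = s).card :=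
      Finset.card_eq_sum_card_fiberwise fun i hi => hS i hi
    have hlt : S.card * T.card < S.card * T.card := by
      calc S.card * T.card = ∑ s ∈ S, T.card := by rw [Finset.sum_const, smul_eq_mul]
        _ = ∑ s ∈ S, T.card := rfl
        _ > ∑ s ∈ S, S.card * (T.filter fun i => cls i = s).card := Finset.sum_lt_sum_of_nonempty
            (Finset.card_pos.1 hSpos) fun s hs => hcon s hs
        _ = S.card * ∑ s ∈ S, (T.filter fun i => cls i = s).card := by rw [Finset.mul_sum]
        _ = S.card * T.card := by rw [← hsum]
    exact lt_irrefl _ hlt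
  have hsub : (⋂ i ∈ T, Bad i) ⊆ ⋂ i ∈ T.filter (fun i => cls i = s), Bad i :=
    Set.biInter_subset_biInter_left (Finset.filter_subset _ T)
  have hroot0 : 0 ≤ δ ^ ((1 : ℝ) / S.card) := Real.rpow_nonneg hδ0 _
  have hroot1 : δ ^ ((1 : ℝ) / S.card) ≤ 1 := Real.rpow_le_one hδ0 hδ1 (by positivity)
  have hS' : (S.card : ℝ) ≠ 0 := by exact_mod_cast hSpos.ne'
  calc μ.real (⋂ i ∈ T, Bad i) ≤ μ.real (⋂ i ∈ T.filter (fun i => cls i = s), Bad i) := measureReal_mono hsub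
    _ ≤ δ ^ (T.filter fun i => cls i = s).card := h s hs
    _ = (δ ^ ((1 : ℝ) / S.card)) ^ (S.card * (T.filter fun i => cls i = s).card) := by
        rw [pow_mul, ← Real.rpow_natCast (δ ^ ((1 : ℝ) / S.card)) S.card, ← Real.rpow_mul hδ0,
          one_div_mul_cancel hS', Real.rpow_one]
    _ ≤ (δ ^ ((1 : ℝ) / S.card)) ^ T.card := pow_le_pow_of_le_one hroot0 hroot1 hbig

/-- **Covering by SEVERAL blocks each (choice functions).**  If every bad event `Bad i` (`i ∈ T`) lies inside the UNION of the
block events `B c` over a set `Nbr i` of at most `m₀` blocks (e.g. the `≤ 2^d` blocks of one tiling meeting a cube), every block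
belongs to `Nbr i` for at most `m₁ ≥ 1` indices `i ∈ T`, and the tiling has multiplicative rarity `μ(⋂_{k∈A} B k) ≤ δ₀^{#A}`
(`0 ≤ δ₀ ≤ 1`), then `μ(⋂_{i∈T} Bad i) ≤ (m₀ · δ₀^{1/m₁})^{#T}`: union bound over the `≤ m₀^{#T}` choice functions, each term bounded
by `measureReal_biInter_le_of_cover`'s argument.  No shifted tilings needed. [folklore] -/
theorem measureReal_biInter_le_of_cover_choice {ι κ : Type*} [DecidableEq ι] [DecidableEq κ] (T : Finset ι)
    (Bad : ι → Set Ω) (B : κ → Set Ω) (hB : ∀ k, MeasurableSet (B k)) (Nbr : ι → Finset κ)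
    (hcover : ∀ i ∈ T, Bad i ⊆ ⋃ k ∈ Nbr i, B k) {m₀ m₁ : ℕ} (hm₀ : ∀ i ∈ T, (Nbr i).card ≤ m₀) (hm₁ : 1 ≤ m₁)
    (hfib : ∀ k, (T.filter fun i => k ∈ Nbr i).card ≤ m₁) {δ₀ : ℝ} (hδ₀ : 0 ≤ δ₀) (hδ₁ : δ₀ ≤ 1)
    (hrare : ∀ A : Finset κ, μ.real (⋂ k ∈ A, B k) ≤ δ₀ ^ A.card) :
    μ.real (⋂ i ∈ T, Bad i) ≤ ((m₀ : ℝ) * δ₀ ^ ((1 : ℝ) / m₁)) ^ T.card := by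
  classical
  -- choice functions on the subtype `↥T`
  set Φ : Finset (∀ i : ↥T, κ) := Fintype.piFinset fun i : ↥T => Nbr i.1 with hΦ
  set ρ₁ : ℝ := δ₀ ^ ((1 : ℝ) / m₁) with hρ₁
  have hρ0 : 0 ≤ ρ₁ := Real.rpow_nonneg hδ₀ _
  have hρ1 : ρ₁ ≤ 1 := Real.rpow_le_one hδ₀ hδ₁ (by positivity)
  -- covering of the intersection by the union over choice functions
  have hsub : (⋂ i ∈ T, Bad i) ⊆ ⋃ f ∈ Φ, ⋂ i : ↥T, B (f i) := by
    intro ω hω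
    have hch : ∀ i : ↥T, ∃ k ∈ Nbr i.1, ω ∈ B k := fun i => by
      have := hcover i.1 i.2 (Set.mem_iInter₂.1 hω i.1 i.2)
      simpa only [Set.mem_iUnion, exists_prop] using this
    choose f hfN hfB using hch
    refine Set.mem_iUnion₂.2 ⟨f, ?_, Set.mem_iInter.2 hfB⟩
    exact Fintype.mem_piFinset.2 hfN
  -- each term: the blocks used by `f`
  have hterm : ∀ f ∈ Φ, μ.real (⋂ i : ↥T, B (f i)) ≤ ρ₁ ^ T.card := by
    intro f hf
    have hfN : ∀ i : ↥T, f i ∈ Nbr i.1 := fun i => Fintype.mem_piFinset.1 hf i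
    set A : Finset κ := Finset.univ.image f with hA
    have hsubA : (⋂ i : ↥T, B (f i)) ⊆ ⋂ k ∈ A, B k := by
      intro ω hω
      refine Set.mem_iInter₂.2 fun k hk => ?_
      obtain ⟨i, -, rfl⟩ := Finset.mem_image.1 hk
      exact Set.mem_iInter.1 hω i
    -- fibres of `f` have size ≤ m₁
    have hcard : (Finset.univ : Finset ↥T).card ≤ m₁ * A.card := by
      refine Finset.card_le_mul_card_image _ _ fun k _ => ?_
      calc (Finset.univ.filter fun i : ↥T => f i = k).card
          ≤ (T.filter fun i => k ∈ Nbr i).card := by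
            refine Finset.card_le_card_of_injOn (fun i => i.1) (fun i hi => ?_) ?_
            · have hik : f i = k := (Finset.mem_filter.1 hi).2
              exact Finset.mem_filter.2 ⟨i.2, hik ▸ hfN i⟩
            · intro a _ b _ h
              exact Subtype.ext h
        _ ≤ m₁ := hfib k
    have hTcard : T.card = (Finset.univ : Finset ↥T).card := by simp
    calc μ.real (⋂ i : ↥T, B (f i)) ≤ μ.real (⋂ k ∈ A, B k) := measureReal_mono hsubA
      _ ≤ δ₀ ^ A.card := hrare A
      _ = ρ₁ ^ (m₁ * A.card) := by
          have hm₁' : (m₁ : ℝ) ≠ 0 := by exact_mod_cast (show m₁ ≠ 0 by omega)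
          rw [pow_mul, hρ₁, ← Real.rpow_natCast (δ₀ ^ ((1 : ℝ) / m₁)) m₁, ← Real.rpow_mul hδ₀,
            one_div_mul_cancel hm₁', Real.rpow_one]
      _ ≤ ρ₁ ^ T.card := pow_le_pow_of_le_one hρ0 hρ1 (hTcard ▸ hcard)
  -- the number of choice functions
  have hΦcard : (Φ.card : ℝ) ≤ (m₀ : ℝ) ^ T.card := by
    have h1 : Φ.card = ∏ i : ↥T, (Nbr i.1).card := Fintype.card_piFinset _
    have h2 : (∏ i : ↥T, (Nbr i.1).card : ℕ) ≤ m₀ ^ (Finset.univ : Finset ↥T).card :=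
      Finset.prod_le_pow_card _ _ _ fun i _ => hm₀ i.1 i.2
    have hTcard : (Finset.univ : Finset ↥T).card = T.card := by simp
    rw [hTcard] at h2
    rw [h1]
    exact_mod_cast h2
  -- union bound
  have hmeasI : ∀ f : ∀ i : ↥T, κ, MeasurableSet (⋂ i : ↥T, B (f i)) := fun f =>
    MeasurableSet.iInter fun i => hB (f i)
  calc μ.real (⋂ i ∈ T, Bad i) ≤ μ.real (⋃ f ∈ Φ, ⋂ i : ↥T, B (f i)) :=
        measureReal_mono hsub (measure_ne_top μ _)
    _ ≤ ∑ f ∈ Φ, μ.real (⋂ i : ↥T, B (f i)) := measureReal_biUnion_finset_le _ _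
    _ ≤ ∑ _f ∈ Φ, ρ₁ ^ T.card := Finset.sum_le_sum hterm
    _ = Φ.card * ρ₁ ^ T.card := by rw [Finset.sum_const, nsmul_eq_mul]
    _ ≤ (m₀ : ℝ) ^ T.card * ρ₁ ^ T.card := mul_le_mul_of_nonneg_right hΦcard (pow_nonneg hρ0 _)
    _ = ((m₀ : ℝ) * ρ₁) ^ T.card := by rw [mul_pow]

end Covering

/-! ## §2 Kernel-level rarity reproduces a ∀-exterior law (consistency of the specification) -/

section TwoTier

open ProbabilityTheory

variable {d N : ℕ} {G : Type*} [Group G] [TopologicalSpace G] [IsTopologicalGroup G]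
  [CompactSpace G] [MeasurableSpace G] [BorelSpace G] [T2Space G] [SecondCountableTopology G]
  (ρ : G →* Matrix (Fin N) (Fin N) ℂ)

/-- **Consistency of the lattice Yang–Mills specification for bounded continuous observables**: for `Λ ⊆ Λ'` and every
outer exterior `ζ`, `∫ (γ_Λ F)(σ) dγ_{Λ'}(σ | ζ) = (γ_{Λ'} F)(ζ)` (Georgii 2011 Def. 1.23 (iii), from the tree's
`isSpecification_ymSpecification_of_t2Space` via Mathlib's kernel composition). [folklore] -/
theorem integral_integral_ymSpecification_of_subset (hρ : Continuous ρ) (β : ℝ) {Λ Λ' : Finset (ZdEdge d)}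
    (h : Λ ⊆ Λ') (ζ : LGConfig d G) {F : LGConfig d G → ℝ} (hF : Continuous F) {C : ℝ} (hC : ∀ U, |F U| ≤ C) :
    ∫ σ, (∫ U, F U ∂(ymSpecification ρ β Λ σ)) ∂(ymSpecification ρ β Λ' ζ) =
      ∫ U, F U ∂(ymSpecification ρ β Λ' ζ) := by
  have hγ := isSpecification_ymSpecification_of_t2Space (d := d) ρ hρ β
  haveI := isProbabilityMeasure_ymSpecification ρ hρ β Λ' ζ
  let κ : Kernel (LGConfig d G) (LGConfig d G) :=
    ⟨ymSpecification ρ β Λ, hγ.measurable_fun Λ⟩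
  have hbind : (ymSpecification ρ β Λ' ζ).bind (ymSpecification ρ β Λ) = ymSpecification ρ β Λ' ζ := by
    ext A hA
    rw [Measure.bind_apply hA (hγ.measurable_fun Λ).aemeasurable]
    exact hγ.consistent h ζ A hA
  have hcomp : (κ ∘ₖ Kernel.const Unit (ymSpecification ρ β Λ' ζ)) () =
      ymSpecification ρ β Λ' ζ := by
    rw [Kernel.comp_apply, Kernel.const_apply]
    exact hbind
  have hfi : Integrable F ((κ ∘ₖ Kernel.const Unit (ymSpecification ρ β Λ' ζ)) ()) := by
    rw [hcomp]
    exact integrable_of_abs_le hF.measurable hC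
  have key := Kernel.integral_comp hfi
  rw [hcomp, Kernel.const_apply] at key
  exact key.symm

/-- **An inner good-exterior law plus the outer kernel's mass of the bad exteriors bounds the OUTER kernel mean, for
every outer exterior.**  For `Λ ⊆ Λ'`, a bounded continuous `F` (`|F| ≤ C`), a measurable set `Good` of exteriors with
`|γ_Λ F(σ) − p| ≤ ε` for `σ ∈ Good`, and ANY `ζ`:  `|γ_{Λ'} F(ζ) − p| ≤ ε + (C + |p|) · γ_{Λ'}(ζ)(Goodᶜ)`.  Hence a
kernel-level rarity `sup_ζ γ_{Λ'}(ζ)(Goodᶜ) ≤ δ` turns the inner good law into a ∀-EXTERIOR law `ε + (C+|p|)δ` for the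
outer volume — the currency the collar consumed before the defect collar, and the one the lead's penetration analysis
refutes; rarity must therefore be asked under the torus state (§1, chessboard), not kernel-wise. [folklore] -/
theorem abs_kernel_sub_le_of_inner_law (hρ : Continuous ρ) (β : ℝ) {Λ Λ' : Finset (ZdEdge d)} (h : Λ ⊆ Λ')
    {F : LGConfig d G → ℝ} (hF : Continuous F) {C : ℝ} (hC : ∀ U, |F U| ≤ C)
    (Good : Set (LGConfig d G)) (hGood : MeasurableSet Good) {p ε : ℝ} (hε : 0 ≤ ε)
    (hlaw : ∀ σ ∈ Good, |(∫ U, F U ∂(ymSpecification ρ β Λ σ)) - p| ≤ ε) (ζ : LGConfig d G) :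
    |(∫ U, F U ∂(ymSpecification ρ β Λ' ζ)) - p| ≤
      ε + (C + |p|) * (ymSpecification ρ β Λ' ζ).real Goodᶜ := by
  haveI := isProbabilityMeasure_ymSpecification ρ hρ β Λ' ζ
  set g : LGConfig d G → ℝ := fun σ => ∫ U, F U ∂(ymSpecification ρ β Λ σ) with hgdef
  have hgc : Continuous g := continuous_integral_ymSpecification ρ hρ β Λ hF hC
  have hgb : ∀ σ, |g σ| ≤ C := fun σ => abs_integral_ymSpecification_le ρ hρ β Λ hC σ
  set χ : LGConfig d G → ℝ := Goodᶜ.indicator (fun _ => (1 : ℝ)) with hχdef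
  have hχm : Measurable χ := measurable_const.indicator hGood.compl
  have hχb : ∀ σ, |χ σ| ≤ 1 := fun σ => by
    simp only [hχdef]
    rw [abs_of_nonneg (Set.indicator_nonneg (fun _ _ => zero_le_one) _)]
    exact Set.indicator_apply_le' (fun _ => le_rfl) (fun _ => zero_le_one)
  have hCp : 0 ≤ C + |p| := by
    have : 0 ≤ C := (abs_nonneg _).trans (hC fun _ => 1)
    positivity
  -- pointwise good/bad split
  have hgp : ∀ σ, |g σ - p| ≤ ε + (C + |p|) * χ σ := by
    intro σ
    by_cases hσ : σ ∈ Good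
    · have h0 : χ σ = 0 := by
        have : σ ∉ Goodᶜ := fun hh => hh hσ
        simp only [hχdef, Set.indicator_of_notMem this]
      rw [h0, mul_zero, add_zero]
      exact hlaw σ hσ
    · have h1 : χ σ = 1 := by simp only [hχdef, Set.indicator_of_mem (Set.mem_compl hσ)]
      rw [h1, mul_one]
      calc |g σ - p| ≤ |g σ| + |p| := abs_sub _ _
        _ ≤ C + |p| := add_le_add_left (hgb σ) _
        _ ≤ ε + (C + |p|) := le_add_of_nonneg_left hε
  -- consistency, then integrate the split
  rw [← integral_integral_ymSpecification_of_subset ρ hρ β h ζ hF hC]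
  have e1 : (∫ σ, g σ ∂(ymSpecification ρ β Λ' ζ)) - p = ∫ σ, (g σ - p) ∂(ymSpecification ρ β Λ' ζ) :=
    (integral_sub_const_of_abs_le hgc.measurable hgb p).symm
  have hχi : Integrable χ (ymSpecification ρ β Λ' ζ) := integrable_of_abs_le hχm hχb
  calc |(∫ σ, g σ ∂(ymSpecification ρ β Λ' ζ)) - p|
      = |∫ σ, (g σ - p) ∂(ymSpecification ρ β Λ' ζ)| := by rw [e1]
    _ ≤ ∫ σ, |g σ - p| ∂(ymSpecification ρ β Λ' ζ) := abs_integral_le_integral_abs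
    _ ≤ ∫ σ, (ε + (C + |p|) * χ σ) ∂(ymSpecification ρ β Λ' ζ) :=
        integral_mono_of_nonneg (ae_of_all _ fun σ => abs_nonneg _)
          ((integrable_const ε).add (hχi.const_mul _)) (ae_of_all _ hgp)
    _ = ε + (C + |p|) * ∫ σ, χ σ ∂(ymSpecification ρ β Λ' ζ) := by
        rw [integral_add (integrable_const ε) (hχi.const_mul _), integral_const, integral_const_mul]
        simp
    _ = ε + (C + |p|) * (ymSpecification ρ β Λ' ζ).real Goodᶜ := by
        rw [hχdef, ← integral_indicator_one hGood.compl]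
        rfl

end TwoTier

end Summit.QuantumFields.YangMills.Cruxes.UVSeamRec.DefectCollar

end
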